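import Summits.BirchSwinnertonDyer.BirchSwinnertonDyer.Theorems.ByReductionTypeAtTwoRankOneAtTwoBigImageOddLocalOneDoorBottomSubslice
import Summits.BirchSwinnertonDyer.BirchSwinnertonDyer.Theorems.ByReductionTypeAtTwoRankOneAtTwoBigImageOddLocalOneDoorBottomOfPrintCTFree
import HarnessLib

/-!
# Route ByReductionTypeAtTwo, crux `RankOneAtTwoBigImageOddLocal` (stmt-BirchSwinnertonDyer-23715), LINE v8.12/v8.13 `one_door_analytic`:
# THE PROVED SUB-SLICE WITHOUT CASSELS–TATE — `BSD₂(W)` at every bottom-rung door modulo FIVE printed facts and rank-`0` `BSD₂` of the twin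

Width prover seat `bsd-line-fkl-p2` g12 (2026-08-28), `--supports stmt-BirchSwinnertonDyer-23715` (helper).  THEOREMS ONLY; no definition, no named
fact introduced, no `sorry`; BSD is not proved by any of this — every statement is CONDITIONAL on PRINT named facts of the tree (taken as hypotheses)
and, where stated, on the route's four rank-`0` cruxes at `2` by name.

The lead's `Theorems/…OneDoorBottomSubslice.lean` (g14, p660863) states the line's positive content as one citable theorem — `BSDp W 2` at every
BOTTOM-RUNG door datum of the slice — modulo SIX printed facts (Gross–Zagier, Kolyvagin, modularity, Hoffstein–Luo, Cassels 1962, Gross 1991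
Prop. 3.7 (2)) and `BSD₂` of the rank-`0` twin.  Cassels–Tate entered only through the bottom rung `doorIndexLawUpperCAtTwoBottom_of_print`; with the
CT-free rung `doorIndexLawUpperCAtTwoBottom_of_print_ctFree` (`Theorems/…OneDoorBottomOfPrintCTFree.lean`: the twin `Sel₂` vanishes by Mazur–Rubin
Cor. 3.4 (i) directed at the door's one error place — `Theorems/…OneDoorBottomFrameCTFree.lean`) the same four theorems hold with the binder
`hCT : exists_casselsTate_pairing` DELETED:

* `bsdp_two_of_bottomRung_at_ctFree` — `BSDp W 2` at a bottom-rung door from FIVE printed facts and `BSDp Wd 2`;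
* `bsdp_two_of_bottomRung_at_of_rankZeroTwin_ctFree` — the twin's `BSD₂` from rank-`0` `BSD₂` of non-CM curves (`S_rankZeroTwin`);
* `bsdp_two_of_bottomRung_at_of_rankZero_cruxes_ctFree` — … from the route's four rank-`0` cruxes BY NAME;
* **`bsdp_two_of_exists_bottomRungDoor_ctFree`** — every `W` of the slice admitting a bottom-rung door datum satisfies `BSDp W 2`, modulo
  Gross–Zagier, Kolyvagin, modularity, Hoffstein–Luo, Gross 3.7 (2) and the four rank-`0` cruxes.

References: [GrossLMS1991] §10, Prop. 3.7 (2); [Kolyvagin1990] Thm. A; [GrossZagier1986] Thm. I.6.3, V.§2; [MazurRubin2010] Cor. 3.4 (i);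
[Kramer1981] Props. 3, 6; [KrizLi2019] Cor. 4.2.
-/

set_option autoImplicit false
-- the Theorems namespace of this sub repeats the summit name by design (D-0017 nested layout)
set_option linter.dupNamespace false

noncomputable section

open scoped Classical

namespace Summit.BirchSwinnertonDyer.BirchSwinnertonDyer.Theorems.RankOneAtTwoOneDoor

open WeierstrassCurve NumberField Literature.NumberTheory.EllipticCurves Literature.NumberTheory.EllipticCurves.ModularForms
  Summit.BirchSwinnertonDyer.BirchSwinnertonDyer.Theses.ByReductionTypeAtTwo

/-- **`BSD₂(W)` AT A BOTTOM-RUNG DOOR, modulo FIVE printed facts and `BSD₂` of the twin (no Cassels–Tate).**  Binders of the lead's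
`bsdp_two_of_bottomRung_at` minus `hCT`: `W/ℚ` globally minimal, non-CM, `ρ_{W,2^n}` onto for all `n`, odd torsion order, odd Tamagawa product, analytic
rank `1`; `K` imaginary quadratic with `d_K` door-admissible and `L(W^{(d_K)},1) ≠ 0`; a parametrisation datum with ODD constant, `H`, `ι`, `P ∈ E(K)`
over the complex Heegner point; `Wd` a globally minimal model of the twist with `BSDp Wd 2`; the door MINIMAL and `P ∉ 2E(K) + E(K)_tors`.  THEN
`BSDp W 2`: the CT-free bottom rung `doorIndexLawUpperCAtTwoBottom_of_print_ctFree` gives `Ш(W)[2^∞] = Ш(Wd)[2^∞] = 0` (`bottom_conclusion_iff`), whence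
the door identity at `m = 0`, whence `BSD₂(W)` by `bsdp_two_iff_doorLawFullC_at_of_rank`.  CONDITIONAL by design; BSD is not proved by this.
[cite: GrossLMS1991, §10 and Prop. 3.7 (2)] [cite: Kolyvagin1990, Thm. A] [cite: GrossZagier1986, Thm. I.6.3 and V.§2] [cite: MazurRubin2010, Cor. 3.4 (i)] -/
theorem bsdp_two_of_bottomRung_at_ctFree
    (hGZ : ∀ (N : ℕ) [NeZero N] (W : WeierstrassCurve ℚ) (K : Type) [Field K] [NumberField K], gross_zagier N W K)
    (hKo : ∀ (N : ℕ) [NeZero N] (W : WeierstrassCurve ℚ) (K : Type) [Field K] [NumberField K], kolyvagin N W K)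
    (hnf : exists_isNewformOf) (hHL : HoffsteinLuo1997_exists_twist_L_one_ne_zero)
    (h37 : Literature.NumberTheory.EllipticCurves.GrossLMS1991.prop37_2_frobeniusCongruence)
    (W : WeierstrassCurve ℚ) [W.IsElliptic] [W.IsGloballyMinimal] [NeZero (W.conductorNorm ℤ)]
    (hCM : ¬ W.HasCM) (hsurj : ∀ n : ℕ, W.HasSurjectiveModNGaloisRep ((2 ^ n : ℕ) : ℤ)) (hT : Odd W.torsionOrder)
    (hc : Odd W.tamagawaProduct) (hr : W.analyticRank = 1)
    (K : Type) [Field K] [NumberField K] (hK : IsImaginaryQuadratic K) (hadm : DoorAdmissible W (NumberField.discr K))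
    (hLt : (W.quadraticTwist (NumberField.discr K : ℚ)).entireLFunction 1 ≠ 0)
    (Dt : ModularParametrizationData W (W.conductorNorm ℤ)) (H : HeegnerDatum (W.conductorNorm ℤ) (NumberField.discr K))
    (ι : K →+* ℂ) (P : (W.baseChange K).toAffine.Point)
    (hP : WeierstrassCurve.Affine.Point.map ι.toRatAlgHom P = heegnerPointComplex Dt H)
    (Wd : WeierstrassCurve ℚ) [Wd.IsElliptic] [Wd.IsGloballyMinimal] (Cd : WeierstrassCurve.VariableChange ℚ)
    (hWd : Cd • W.quadraticTwist (NumberField.discr K : ℚ) = Wd)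
    (hmin : transpCount W (NumberField.discr K) + 2 * identCount W (NumberField.discr K) = (if W.Δ < 0 then 1 else 0))
    (hodd : Odd Dt.c) (hm0 : HasTwoDivisibilityUpToTorsion W K P 0) (hBd : BSDp Wd 2) :
    BSDp W 2 := by
  haveI : Fact (Nat.Prime 2) := ⟨Nat.prime_two⟩
  -- the CT-free bottom rung U₀ from print, at this datum
  have hU0 := doorIndexLawUpperCAtTwoBottom_of_print_ctFree hGZ hKo hnf hHL h37 W hCM hsurj hT hc hr K hK hadm hLt Dt H ι P hP Wd Cd
    hWd hmin hodd hm0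
  obtain ⟨hsW, hsd⟩ := (bottom_conclusion_iff W (NumberField.discr K) Dt.c _ _ hmin hodd).mp hU0
  -- the per-datum equivalence `BSD₂(W) ↔ law`, read from right to left at `m = 0`
  have hmod : hasEntireLFunction_rat := hasEntireLFunction_rat_of_exists_isNewformOf hnf
  have hrk : W.mordellWeilRank = 1 :=
    (mordellWeilRank_eq_one_of_analyticRank_eq_one_of_isGloballyMinimal hGZ hKo hnf hHL W hr).1
  have hHN : SatisfiesHeegnerHypothesis (W.conductorNorm ℤ) K := satisfiesHeegnerHypothesis_of_doorAdmissible W K hK hadm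
  obtain ⟨-, -, hiff⟩ :=
    bsdp_two_iff_doorLawFullC_at_of_rank hmod doorTwistTamagawaAtTwo W hT hc hr hrk K hK (hGZ _ W K) (hKo _ W K) hadm hHN hLt
      Dt H ι P hP Wd Cd hWd hBd
  refine hiff.mpr ⟨0, hm0, ?_⟩
  have hc2 : ¬ (2 : ℤ) ∣ Dt.c := fun h => Int.not_even_iff_odd.mpr hodd (even_iff_two_dvd.mpr h)
  rw [hsW, hsd, padicValInt.eq_zero_of_not_dvd hc2]
  by_cases hΔ : W.Δ < 0
  · rw [if_pos hΔ] at hmin ⊢; omega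
  · rw [if_neg hΔ] at hmin ⊢; omega

/-- **`BSD₂(W)` at a bottom-rung door, the twin's `BSD₂` supplied by rank-`0` `BSD₂` for non-CM curves** (`S_rankZeroTwin`), no Cassels–Tate: the
twist model `Wd` is non-CM of analytic rank `0`.  CONDITIONAL by design; BSD is not proved by this. [cite: GrossLMS1991, §10] [cite: Kolyvagin1990, Thm. A] -/
theorem bsdp_two_of_bottomRung_at_of_rankZeroTwin_ctFree
    (hGZ : ∀ (N : ℕ) [NeZero N] (W : WeierstrassCurve ℚ) (K : Type) [Field K] [NumberField K], gross_zagier N W K)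
    (hKo : ∀ (N : ℕ) [NeZero N] (W : WeierstrassCurve ℚ) (K : Type) [Field K] [NumberField K], kolyvagin N W K)
    (hnf : exists_isNewformOf) (hHL : HoffsteinLuo1997_exists_twist_L_one_ne_zero)
    (h37 : Literature.NumberTheory.EllipticCurves.GrossLMS1991.prop37_2_frobeniusCongruence)
    (hZ : S_rankZeroTwin)
    (W : WeierstrassCurve ℚ) [W.IsElliptic] [W.IsGloballyMinimal] [NeZero (W.conductorNorm ℤ)]
    (hCM : ¬ W.HasCM) (hsurj : ∀ n : ℕ, W.HasSurjectiveModNGaloisRep ((2 ^ n : ℕ) : ℤ)) (hT : Odd W.torsionOrder)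
    (hc : Odd W.tamagawaProduct) (hr : W.analyticRank = 1)
    (K : Type) [Field K] [NumberField K] (hK : IsImaginaryQuadratic K) (hadm : DoorAdmissible W (NumberField.discr K))
    (hLt : (W.quadraticTwist (NumberField.discr K : ℚ)).entireLFunction 1 ≠ 0)
    (Dt : ModularParametrizationData W (W.conductorNorm ℤ)) (H : HeegnerDatum (W.conductorNorm ℤ) (NumberField.discr K))
    (ι : K →+* ℂ) (P : (W.baseChange K).toAffine.Point)
    (hP : WeierstrassCurve.Affine.Point.map ι.toRatAlgHom P = heegnerPointComplex Dt H)
    (Wd : WeierstrassCurve ℚ) [Wd.IsElliptic] [Wd.IsGloballyMinimal] (Cd : WeierstrassCurve.VariableChange ℚ)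
    (hWd : Cd • W.quadraticTwist (NumberField.discr K : ℚ) = Wd)
    (hmin : transpCount W (NumberField.discr K) + 2 * identCount W (NumberField.discr K) = (if W.Δ < 0 then 1 else 0))
    (hodd : Odd Dt.c) (hm0 : HasTwoDivisibilityUpToTorsion W K P 0) :
    BSDp W 2 := by
  have hmod : hasEntireLFunction_rat := hasEntireLFunction_rat_of_exists_isNewformOf hnf
  have hD0 : (NumberField.discr K : ℚ) ≠ 0 := by exact_mod_cast NumberField.discr_ne_zero K
  haveI hEt : (W.quadraticTwist (NumberField.discr K : ℚ)).IsElliptic := W.isElliptic_quadraticTwist hD0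
  have hCMd : ¬ Wd.HasCM := RamifiedPairUpperBound.not_hasCM_of_smul_quadraticTwist_eq hD0 hWd hCM
  have hLeq : Wd.entireLFunction = (W.quadraticTwist (NumberField.discr K : ℚ)).entireLFunction := by
    rw [← hWd, entireLFunction_smul]
  have hrd : Wd.analyticRank = 0 :=
    (Wd.analyticRank_eq_zero_iff_holds (hmod Wd)).2 (by rw [hLeq]; exact hLt)
  exact bsdp_two_of_bottomRung_at_ctFree hGZ hKo hnf hHL h37 W hCM hsurj hT hc hr K hK hadm hLt Dt H ι P hP Wd Cd hWd hmin hodd hm0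
    (hZ Wd hCMd hrd)

/-- **`BSD₂(W)` at a bottom-rung door, the twin's `BSD₂` supplied by the route's four rank-`0` cruxes at `2` BY NAME**, no Cassels–Tate
(`bsdp_two_of_rankZero_cruxes`).  CONDITIONAL by design; BSD is not proved by this. [cite: GrossLMS1991, §10] [cite: Kolyvagin1990, Thm. A] -/
theorem bsdp_two_of_bottomRung_at_of_rankZero_cruxes_ctFree
    (hGZ : ∀ (N : ℕ) [NeZero N] (W : WeierstrassCurve ℚ) (K : Type) [Field K] [NumberField K], gross_zagier N W K)
    (hKo : ∀ (N : ℕ) [NeZero N] (W : WeierstrassCurve ℚ) (K : Type) [Field K] [NumberField K], kolyvagin N W K)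
    (hnf : exists_isNewformOf) (hHL : HoffsteinLuo1997_exists_twist_L_one_ne_zero)
    (h37 : Literature.NumberTheory.EllipticCurves.GrossLMS1991.prop37_2_frobeniusCongruence)
    (hZ4 : GoodOrdinaryRankZeroAtTwo ∧ MultiplicativeRankZeroAtTwo ∧ SupersingularRankZeroAtTwo ∧ AdditiveRankZeroAtTwo)
    (W : WeierstrassCurve ℚ) [W.IsElliptic] [W.IsGloballyMinimal] [NeZero (W.conductorNorm ℤ)]
    (hCM : ¬ W.HasCM) (hsurj : ∀ n : ℕ, W.HasSurjectiveModNGaloisRep ((2 ^ n : ℕ) : ℤ)) (hT : Odd W.torsionOrder)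
    (hc : Odd W.tamagawaProduct) (hr : W.analyticRank = 1)
    (K : Type) [Field K] [NumberField K] (hK : IsImaginaryQuadratic K) (hadm : DoorAdmissible W (NumberField.discr K))
    (hLt : (W.quadraticTwist (NumberField.discr K : ℚ)).entireLFunction 1 ≠ 0)
    (Dt : ModularParametrizationData W (W.conductorNorm ℤ)) (H : HeegnerDatum (W.conductorNorm ℤ) (NumberField.discr K))
    (ι : K →+* ℂ) (P : (W.baseChange K).toAffine.Point)
    (hP : WeierstrassCurve.Affine.Point.map ι.toRatAlgHom P = heegnerPointComplex Dt H)
    (Wd : WeierstrassCurve ℚ) [Wd.IsElliptic] [Wd.IsGloballyMinimal] (Cd : WeierstrassCurve.VariableChange ℚ)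
    (hWd : Cd • W.quadraticTwist (NumberField.discr K : ℚ) = Wd)
    (hmin : transpCount W (NumberField.discr K) + 2 * identCount W (NumberField.discr K) = (if W.Δ < 0 then 1 else 0))
    (hodd : Odd Dt.c) (hm0 : HasTwoDivisibilityUpToTorsion W K P 0) :
    BSDp W 2 :=
  bsdp_two_of_bottomRung_at_of_rankZeroTwin_ctFree hGZ hKo hnf hHL h37
    (fun V _ _ hVCM hV0 => bsdp_two_of_rankZero_cruxes hZ4 V hVCM hV0)
    W hCM hsurj hT hc hr K hK hadm hLt Dt H ι P hP Wd Cd hWd hmin hodd hm0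

/-- **THE PROVED SUB-SLICE OF THE CRUX `RankOneAtTwoBigImageOddLocal`, WITHOUT CASSELS–TATE.**  For every `W/ℚ` of the crux's slice (globally
minimal, non-CM, `ρ_{W,2^n}` onto for all `n`, odd torsion order, odd Tamagawa product, analytic rank `1`) that ADMITS A BOTTOM-RUNG DOOR DATUM — an
imaginary quadratic `K` with `d_K` door-admissible, `L(W^{(d_K)}, 1) ≠ 0` and the door minimal (`t + 2s = [Δ_W < 0]`), a parametrisation datum of level
`N_W` with odd constant, a Heegner point `P ∈ E(K)` over it that is not `2`-divisible modulo torsion, and a globally minimal model of the twist —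
`BSDp W 2` holds, CONDITIONALLY on FIVE PRINT named facts (Gross–Zagier, Kolyvagin, modularity, Hoffstein–Luo, Gross 1991 Prop. 3.7 (2)) and on the
route's four rank-`0` cruxes at `2` BY NAME.  The lead's `bsdp_two_of_exists_bottomRungDoor` minus Cassels 1962.  BSD is not proved by this.
[cite: GrossLMS1991, §10 and Prop. 3.7 (2)] [cite: Kolyvagin1990, Thm. A] [cite: GrossZagier1986, Thm. I.6.3 and V.§2] [cite: MazurRubin2010, Cor. 3.4 (i)]
[cite: KrizLi2019, Cor. 4.2] -/
theorem bsdp_two_of_exists_bottomRungDoor_ctFree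
    (hGZ : ∀ (N : ℕ) [NeZero N] (W : WeierstrassCurve ℚ) (K : Type) [Field K] [NumberField K], gross_zagier N W K)
    (hKo : ∀ (N : ℕ) [NeZero N] (W : WeierstrassCurve ℚ) (K : Type) [Field K] [NumberField K], kolyvagin N W K)
    (hnf : exists_isNewformOf) (hHL : HoffsteinLuo1997_exists_twist_L_one_ne_zero)
    (h37 : Literature.NumberTheory.EllipticCurves.GrossLMS1991.prop37_2_frobeniusCongruence)
    (hZ4 : GoodOrdinaryRankZeroAtTwo ∧ MultiplicativeRankZeroAtTwo ∧ SupersingularRankZeroAtTwo ∧ AdditiveRankZeroAtTwo)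
    (W : WeierstrassCurve ℚ) [W.IsElliptic] [W.IsGloballyMinimal] [NeZero (W.conductorNorm ℤ)]
    (hCM : ¬ W.HasCM) (hsurj : ∀ n : ℕ, W.HasSurjectiveModNGaloisRep ((2 ^ n : ℕ) : ℤ)) (hT : Odd W.torsionOrder)
    (hc : Odd W.tamagawaProduct) (hr : W.analyticRank = 1)
    (hdoor : ∃ (K : Type) (_ : Field K) (_ : NumberField K), IsImaginaryQuadratic K ∧ DoorAdmissible W (NumberField.discr K) ∧
      (W.quadraticTwist (NumberField.discr K : ℚ)).entireLFunction 1 ≠ 0 ∧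
      transpCount W (NumberField.discr K) + 2 * identCount W (NumberField.discr K) = (if W.Δ < 0 then 1 else 0) ∧
      ∃ (Dt : ModularParametrizationData W (W.conductorNorm ℤ)) (H : HeegnerDatum (W.conductorNorm ℤ) (NumberField.discr K))
        (ι : K →+* ℂ) (P : (W.baseChange K).toAffine.Point) (Wd : WeierstrassCurve ℚ) (_ : Wd.IsElliptic) (_ : Wd.IsGloballyMinimal)
        (Cd : WeierstrassCurve.VariableChange ℚ),
        WeierstrassCurve.Affine.Point.map ι.toRatAlgHom P = heegnerPointComplex Dt H ∧
          Cd • W.quadraticTwist (NumberField.discr K : ℚ) = Wd ∧ Odd Dt.c ∧ HasTwoDivisibilityUpToTorsion W K P 0) :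
    BSDp W 2 := by
  obtain ⟨K, _, _, hK, hadm, hLt, hmin, Dt, H, ι, P, Wd, _, _, Cd, hP, hWd, hodd, hm0⟩ := hdoor
  exact bsdp_two_of_bottomRung_at_of_rankZero_cruxes_ctFree hGZ hKo hnf hHL h37 hZ4 W hCM hsurj hT hc hr K hK hadm hLt Dt H ι P hP Wd Cd
    hWd hmin hodd hm0

end Summit.BirchSwinnertonDyer.BirchSwinnertonDyer.Theorems.RankOneAtTwoOneDoor

end
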